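import Summits.NavierStokesRegularity.NavierStokesRegularity.Theorems.LerayQuarterDissipationFiniteDissipationLiouvilleVorticityAlignmentLocal
import HarnessLib

/-!
# Crux `FiniteDissipationLiouville` (stmt-NavierStokesRegularity-22144): vorticity alignment on
# CONCENTRATING BALLS along ONE sequence of times is excluded for the residue (the
# finite-dissipation, sign-blind form of Barker–Prange 2020, Theorem 3)

Theorems file of route `LerayQuarterDissipation` (lead prover ns-lqd-lead g8; `--supports` the
crux, line `birth`). Navier–Stokes regularity is NOT proved by anything here; no summit is.

Barker–Prange 2020, Thm. 3 (whole space; discharged in the tree for classical Leray–Hopf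
solutions with a global Type-I bound, `barkerPrange2020_alignment_concentrating_typeI_holds`):
continuous alignment of the vorticity direction with a modulus `η` on the large-vorticity part of
the concentrating balls `B(x₀, a√(T − tₙ))` along a sequence `tₙ ↑ T` prevents a singularity at
`(x₀, T)`. Here, for SINGULAR members of `𝒟_{C,K}` (apex at the origin), the SIGN-BLIND form with
any level `d ≥ 0`, any `a > 0`, any modulus `η → 0⁺` and ANY sequence `tₙ → 0⁻` is excluded
(`not_alignment_concentrating_of_singular`): at a late `tₙ` the two `δ(C,K,a)`-incoherent points
of the local direction-oscillation floor (`directionOscillation_floor_local`) lie in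
`B(0, a√(−tₙ))`, carry vorticity `> δ/(−tₙ) > d` and are `2a√(−tₙ)`-close, where `η < δ`.

HONEST FRAMING. Portrait fact; the printed theorem concerns Leray–Hopf blow-up and is already in
the tree; this is its analogue inside the finite-dissipation ancient class, with a weaker
(sign-blind, `η → 0⁺` only) hypothesis, obtained from the one-slice leaf rather than from a zoom.

References: Barker–Prange 2020 (ARMA 235 = arXiv:1906.08225), Thm. 3; Giga–Miura 2011, Thm 2.10.
-/

noncomputable section

-- the summit and its single sub-problem share the name (CONVENTIONS §1), as in every Theorems file
set_option linter.dupNamespace false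

namespace Summit.NavierStokesRegularity.NavierStokesRegularity.Theorems.FiniteDissipationLiouville.VorticityAlignment

open MeasureTheory Set Filter Topology Metric Function
open Literature.Analysis Literature.Analysis.FluidPDE
open Summit.NavierStokesRegularity.NavierStokesRegularity.Theorems.FiniteDissipationLiouville
open scoped ENNReal NNReal RealInnerProductSpace

/-- **No sign-blind vorticity alignment on concentrating balls along any sequence of times, for a
singular member of `𝒟_{C,K}`** (finite-dissipation ancient form of Barker–Prange 2020, Thm. 3):
there are no `a > 0`, `d ≥ 0`, modulus `η → 0⁺` and sequence `tₙ → 0⁻` with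
`min(‖ξ(x,tₙ) − ξ(y,tₙ)‖, ‖ξ(x,tₙ) + ξ(y,tₙ)‖) ≤ η(‖x − y‖)` for all `x, y ∈ B(0, a√(−tₙ))` of
vorticity `> d`. [cite: BarkerPrange2020Alignment, Thm. 3 (arXiv:1906.08225 p. 18)] [cite: GigaMiura2011, Thm 2.10 (HUPS preprint #956 p. 10)] -/
theorem not_alignment_concentrating_of_singular {C K : ℝ}
    {w : ℝ → EuclideanSpace ℝ (Fin 3) → EuclideanSpace ℝ (Fin 3)}
    (hw : IsTypeIAncientMild C w)
    (hlaw : ∀ s : ℝ, s < 0 → ∫⁻ x, ‖fderiv ℝ (w s) x‖ₑ ^ 2 ≤ ENNReal.ofReal (K / Real.sqrt (-s)))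
    (hsing : ∀ ρ > 0, ∀ M : ℝ, ∃ t ∈ Ioo (-(ρ ^ 2)) (0 : ℝ),
      ∃ x ∈ ball (0 : EuclideanSpace ℝ (Fin 3)) ρ, M < ‖w t x‖) :
    ¬ (∃ a : ℝ, 0 < a ∧ ∃ d : ℝ, 0 ≤ d ∧ ∃ η : ℝ → ℝ, Tendsto η (𝓝[>] 0) (𝓝 0) ∧
        ∃ tseq : ℕ → ℝ, (∀ n, tseq n < 0) ∧ Tendsto tseq atTop (𝓝 0) ∧
        ∀ n, ∀ x ∈ ball (0 : EuclideanSpace ℝ (Fin 3)) (a * Real.sqrt (-tseq n)),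
          ∀ y ∈ ball (0 : EuclideanSpace ℝ (Fin 3)) (a * Real.sqrt (-tseq n)),
            d < ‖curl (w (tseq n)) x‖ → d < ‖curl (w (tseq n)) y‖ →
            min ‖vorticityDirection (curl (w (tseq n))) x - vorticityDirection (curl (w (tseq n))) y‖
                ‖vorticityDirection (curl (w (tseq n))) x + vorticityDirection (curl (w (tseq n))) y‖ ≤
              η ‖x - y‖) := by
  rintro ⟨a, ha, d, hd, η, hη, tseq, hneg, hto, hD⟩
  obtain ⟨δ, hδ, hfloor⟩ := directionOscillation_floor_local C K a ha
  have hfl := hfloor w hw hlaw hsing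
  -- `η < δ` on some `(0, s₀)`
  obtain ⟨s₀, hs₀, hηs⟩ : ∃ s₀ > 0, ∀ s, 0 < s → s < s₀ → η s < δ := by
    rcases (nhdsGT_basis (0 : ℝ)).eventually_iff.1 (hη.eventually (gt_mem_nhds hδ))
      with ⟨s₀, hs₀, hsub⟩
    exact ⟨s₀, hs₀, fun s h1 h2 => hsub ⟨h1, h2⟩⟩
  -- `-tseq n → 0⁺`: eventually `(-tseq n) (d + 1) < δ` and `2 a √(-tseq n) < s₀`
  have hneg' : Tendsto (fun n => -tseq n) atTop (𝓝 0) := by simpa using hto.neg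
  have hev3 : ∀ᶠ n in atTop, (-tseq n) * (d + 1) < δ := by
    have : Tendsto (fun n => (-tseq n) * (d + 1)) atTop (𝓝 (0 * (d + 1))) := hneg'.mul_const _
    rw [zero_mul] at this
    exact this.eventually (gt_mem_nhds hδ)
  have hev4 : ∀ᶠ n in atTop, 2 * (a * Real.sqrt (-tseq n)) < s₀ := by
    have hs : Tendsto (fun n => Real.sqrt (-tseq n)) atTop (𝓝 0) := by
      have h := (Real.continuous_sqrt.tendsto (0 : ℝ)).comp hneg'
      rwa [Function.comp_def, Real.sqrt_zero] at h
    have : Tendsto (fun n => 2 * (a * Real.sqrt (-tseq n))) atTop (𝓝 0) := by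
      simpa using (hs.const_mul a).const_mul 2
    exact this.eventually (gt_mem_nhds hs₀)
  obtain ⟨n, hn3, hn4⟩ := (hev3.and hev4).exists
  have ht : tseq n < 0 := hneg n
  have hτ0 : 0 < -tseq n := neg_pos.2 ht
  obtain ⟨x, hx, y, hy, hlx, hly, hdiff, hsum⟩ := hfl (tseq n) ht
  -- the levels
  have hlev : ∀ z, δ < (-tseq n) * ‖curl (w (tseq n)) z‖ → d < ‖curl (w (tseq n)) z‖ := by
    intro z hz
    by_contra hle
    push Not at hle
    have : (-tseq n) * ‖curl (w (tseq n)) z‖ ≤ (-tseq n) * (d + 1) :=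
      mul_le_mul_of_nonneg_left (by linarith) hτ0.le
    linarith
  have key := hD n x hx y hy (hlev x hlx) (hlev y hly)
  -- `0 < ‖x − y‖ < s₀`
  have hxy0 : 0 < ‖x - y‖ := by
    rw [norm_pos_iff, sub_ne_zero]
    rintro rfl
    rw [sub_self, norm_zero] at hdiff
    exact lt_irrefl _ (hdiff.trans hδ)
  have hxy1 : ‖x - y‖ < s₀ := by
    have hx' := mem_ball_zero_iff.1 hx
    have hy' := mem_ball_zero_iff.1 hy
    calc ‖x - y‖ ≤ ‖x‖ + ‖y‖ := norm_sub_le x y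
      _ < 2 * (a * Real.sqrt (-tseq n)) := by linarith
      _ < s₀ := hn4
  have hηlt := hηs ‖x - y‖ hxy0 hxy1
  have hmin : δ < min ‖vorticityDirection (curl (w (tseq n))) x - vorticityDirection (curl (w (tseq n))) y‖
      ‖vorticityDirection (curl (w (tseq n))) x + vorticityDirection (curl (w (tseq n))) y‖ :=
    lt_min hdiff hsum
  linarith

end Summit.NavierStokesRegularity.NavierStokesRegularity.Theorems.FiniteDissipationLiouville.VorticityAlignment

end
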